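import Mathlib

/-!
# STUB-IDEAS k2 g15 — `stub_heegnerIndexLowerAtTwo` (crux stmt-BirchSwinnertonDyer-27851)

Typed sketch for the card `Ideas/stub_heegnerIndexLowerAtTwo-k2.md` (k2, gen 15,
technique = literature transfer with a typed dictionary).  Mathlib-only bookkeeping:
no tree declaration is concluded, nothing here proves BSD, the crux, the stub or S2′.

Sections
* §A  in-kernel sanity checks of the three dyadic Gauss-sum laws `g(χ)² = χ(-1)·2ⁿ`
      (χ = χ₋₄, χ₈, χ₋₈; n = 2, 3, 3) in the finite-field avatar `ZMod 17`
      (`2` is a primitive 8th root of unity mod 17, `4` a primitive 4th root).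
* §B  PLAN 1 (R121′ «Gauss digit»): doubled 2-adic valuations of de Shalit's
      like-Gauss-sum `G(ε) = φᵏφ̄ʲ(𝔭ⁿ)/pⁿ · g(χ_𝔭)` (II.4.11 (30) / II.4.14 (37)) for a
      𝔭-component whose restriction to units is quadratic of exact conductor 2ⁿ;
      the conjugate PAIR of Katz factors (types (1,0) and (0,1)) has net digit 0, and the
      LZZ weight-0 multiplier `(L²/ε)_𝔭` is a unit: the 𝔭-local table is constant in the
      pair/LZZ currency and equals `∓n` in a single-factor currency (trichotomy).
* §C  PLAN 2 (ρ3 «direction digit»): the p-adic functional equation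
      `L_p(ε) = W^{padic}(ε)·(ε̌(σ₋δ)/ε(σ_δ))·L_p(ε̌)` with a UNIT p-adic root number
      (de Shalit II.6.4 (9)) forces equal valuations in the two directions; geometric
      avatar: c-conjugate direction scalars have opposite digits, a rational one has digit 0.
* §D  PLAN 3 ((a-norm) «renormalisation acts by units»): the doubled valuation of the
      Tamagawa-free quotient is invariant under every admissible renormalisation whose
      factors are units or cancel between `val` and `log²`.
-/

namespace Summit.BirchSwinnertonDyer.BirchSwinnertonDyer.Cruxes.SplitBadTwoLowerHalfOfFacts.HeegnerIndexTwo.K2G15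

/-! ## §A  Dyadic Gauss-sum laws, finite-field avatar (kernel-checked by `decide`) -/

section GaussAvatar

/-- `ζ₈ := 2` in `ZMod 17` is a primitive 8th root of unity (`2⁴ = -1`). -/
theorem zeta8_pow_four : (2 : ZMod 17) ^ 4 = -1 := by decide

/-- `i := 4 = ζ₈²` is a primitive 4th root of unity in `ZMod 17`. -/
theorem i_sq : (4 : ZMod 17) ^ 2 = -1 := by decide

/-- Gauss sum of `χ₋₄` (values `1, -1` on `1, 3 mod 4`) against `a ↦ i^a`:
`g = i - i³`, and `g² = χ₋₄(-1)·4 = -4`  (conductor exponent n = 2). -/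
theorem gauss_chi_neg4_sq :
    ((4 : ZMod 17) ^ 1 - (4 : ZMod 17) ^ 3) ^ 2 = -4 := by decide

/-- Gauss sum of `χ₈` (values `1,-1,-1,1` on `1,3,5,7 mod 8`) against `a ↦ ζ₈^a`:
`g² = χ₈(-1)·8 = 8`  (conductor exponent n = 3). -/
theorem gauss_chi8_sq :
    ((2 : ZMod 17) ^ 1 - 2 ^ 3 - 2 ^ 5 + 2 ^ 7) ^ 2 = 8 := by decide

/-- Gauss sum of `χ₋₈` (values `1,1,-1,-1` on `1,3,5,7 mod 8`): `g² = χ₋₈(-1)·8 = -8`. -/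
theorem gauss_chi_neg8_sq :
    ((2 : ZMod 17) ^ 1 + 2 ^ 3 - 2 ^ 5 - 2 ^ 7) ^ 2 = -8 := by decide

end GaussAvatar

/-! ## §B  PLAN 1 — the Gauss digit of the Katz pair and the LZZ unit

Doubled valuations (`w = 2·v₂`) keep everything in `ℤ`.  The two axioms of a row are
read off the page: `norm` is `G(ε)·conj G(ε) = p^{n(k+j-1)}` (de Shalit II.4.11, Remark (i),
extended from type (k,0) to (k,j) by the definition (37)); `atP` is the 𝔓-adic valuation of
`φᵏφ̄ʲ(𝔭ⁿ)/pⁿ·g` when `g² = ±2ⁿ` (quadratic unit part: §A), i.e. `2·v_𝔓 G = 2nk - 2n + n`. -/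

/-- One Katz interpolation row at a 𝔭-ramified point of exact conductor exponent `n`,
infinity type `(k, j)`, with doubled valuations of the like-Gauss-sum `G(ε)` at `𝔓` and `𝔓̄`. -/
structure KatzGaussRow where
  n : ℤ
  k : ℤ
  j : ℤ
  wP : ℤ      -- 2 · v_𝔓 G(ε)
  wPbar : ℤ   -- 2 · v_𝔓̄ G(ε)
  norm : wP + wPbar = 2 * n * (k + j - 1)
  atP : wP = 2 * n * k - 2 * n + n

namespace KatzGaussRow

/-- Type (1,0) (the in-range factor `ψ₀χ′` of the pair): digit `+n` at `𝔓`, `-n` at `𝔓̄`. -/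
theorem type10 (r : KatzGaussRow) (hk : r.k = 1) (hj : r.j = 0) :
    r.wP = r.n ∧ r.wPbar = -r.n := by
  have h1 := r.norm; have h2 := r.atP
  rw [hk, hj] at h1; rw [hk] at h2
  constructor <;> omega

/-- Type (0,1) (the out-of-range factor `ψ₀*χ′`, Rubin's value): digit `-n` at `𝔓`. -/
theorem type01 (r : KatzGaussRow) (hk : r.k = 0) (hj : r.j = 1) :
    r.wP = -r.n ∧ r.wPbar = r.n := by
  have h1 := r.norm; have h2 := r.atP
  rw [hk, hj] at h1; rw [hk] at h2
  constructor <;> omega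

end KatzGaussRow

/-- PAIR CANCELLATION: at the same key (same `n`) the conjugate pair of Katz factors
(types (1,0) and (0,1)) has net Gauss digit `0` at `𝔓` (and at `𝔓̄`). -/
theorem katzPair_gaussDigit_zero (r₁ r₂ : KatzGaussRow) (hn : r₁.n = r₂.n)
    (h₁k : r₁.k = 1) (h₁j : r₁.j = 0) (h₂k : r₂.k = 0) (h₂j : r₂.j = 1) :
    r₁.wP + r₂.wP = 0 ∧ r₁.wPbar + r₂.wPbar = 0 := by
  obtain ⟨a, b⟩ := r₁.type10 h₁k h₁j
  obtain ⟨c, d⟩ := r₂.type01 h₂k h₂j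
  constructor <;> omega

/-- LZZ weight-0 multiplier `(L²/ε)_𝔭` at `π_𝔭` unramified, `χ_{𝔓ᶜ}` quadratic ramified:
`L = 1` and `ε(½, π_𝔭 ⊗ χ) = ε(½, χ, ψ)² = χ(-1)`, so its doubled valuation `wε`
satisfies `wε + wε = 0` (the square is a sign) — hence `wε = 0`. -/
theorem lzz_weightZero_unit (wε : ℤ) (hsq : wε + wε = 0) : wε = 0 := by omega

/-- The 𝔭-LOCAL TABLE in the pair/LZZ currency: per dyadic key with conductor exponent
`n ∈ {2, 3}` the column `λ = (pair Gauss digit) - (LZZ weight-0 digit)` vanishes, so it is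
(trivially) key-typed and constant. -/
theorem twoLocalTable_pairCurrency
    (col : ℤ → ℤ)                       -- column indexed by the conductor exponent n
    (pair lzz : ℤ → ℤ) (hcol : ∀ n, col n = pair n - lzz n)
    (hpair : ∀ n, pair n = 0) (hlzz : ∀ n, lzz n = 0) :
    ∃ c : ℤ, ∀ n, col n = c := ⟨0, fun n => by rw [hcol, hpair, hlzz]; simp⟩

/-- CURRENCY TRICHOTOMY.  If the LEAD's `val` is (a) the LZZ/pair value, (b) Rubin's single
out-of-range Katz value (type (0,1)), or (c) the single in-range value (type (1,0)), the Gauss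
column is `a₀ + b·n` with `b ∈ {0, -1, 1}` respectively; two anchors with `n = 2` and `n = 3`
DECIDE `b` (the cheapest falsifier of PLAN 1: `b := col 3 - col 2`). -/
theorem currency_decided_by_two_anchors (col : ℤ → ℤ) (a₀ b : ℤ)
    (haff : ∀ n, col n = a₀ + b * n) : b = col 3 - col 2 := by
  have h2 := haff 2; have h3 := haff 3; omega

/-- … and a column that is NOT of the form `a₀ + b·n` with `b ∈ {0,-1,1}` on the two dyadic
exponents refutes all three currencies at once. -/
theorem currency_refuted (col : ℤ → ℤ)
    (h : ∀ b : ℤ, (b = 0 ∨ b = -1 ∨ b = 1) → col 3 - col 2 ≠ b) :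
    ¬ ∃ a₀ b : ℤ, (b = 0 ∨ b = -1 ∨ b = 1) ∧ ∀ n, col n = a₀ + b * n := by
  rintro ⟨a₀, b, hb, haff⟩
  exact h b hb (currency_decided_by_two_anchors col a₀ b haff).symm

/-! ## §C  PLAN 2 — direction digit from the p-adic functional equation -/

/-- de Shalit II.6.4 (9): `L_p(ε) = W·r·L_p(ε̌)` with `W = W^{padic}(ε)` a p-adic UNIT and
`r = ε̌(σ₋δ)/ε(σ_δ)` a unit (values of characters on `σ_{±δ}`, `δ ∈ ℤ_p^×`); in doubled
valuations `wL = wW + wr + wLcheck` with `wW = wr = 0`, so the two DIRECTIONS carry the same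
valuation: the analytic direction digit vanishes. -/
theorem directionDigit_analytic_zero (wL wLcheck wW wr : ℤ)
    (fe : wL = wW + wr + wLcheck) (hW : wW = 0) (hr : wr = 0) : wL = wLcheck := by omega

/-- A scalar of the CM coefficient field seen at the two places above 2. -/
structure TwoPlaceVal where
  vP : ℤ
  vPbar : ℤ

namespace TwoPlaceVal

/-- Complex conjugation swaps the two places. -/
def conj (a : TwoPlaceVal) : TwoPlaceVal := ⟨a.vPbar, a.vP⟩

/-- Product of scalars adds valuations. -/
def mul (a b : TwoPlaceVal) : TwoPlaceVal := ⟨a.vP + b.vP, a.vPbar + b.vPbar⟩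

/-- The direction digit of a scalar: its 𝔓̄-vs-𝔓 asymmetry. -/
def digit (a : TwoPlaceVal) : ℤ := a.vPbar - a.vP

@[simp] theorem conj_vP (a : TwoPlaceVal) : a.conj.vP = a.vPbar := rfl
@[simp] theorem conj_vPbar (a : TwoPlaceVal) : a.conj.vPbar = a.vP := rfl

/-- A rational scalar (e.g. anything built from `P ∈ W(ℚ)` and a rational `ω`) is balanced. -/
theorem digit_zero_of_rational (a : TwoPlaceVal) (h : a.vP = a.vPbar) : a.digit = 0 := by
  unfold digit; omega

/-- Conjugate scalars have opposite digits … -/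
theorem digit_conj (a : TwoPlaceVal) : a.conj.digit = -a.digit := by
  unfold digit conj; simp

/-- … so the CONJUGATE-PAIR symmetrisation of T3.2 kills the digit: if the partner run's
direction scalar is `conj a` times a unit `u` (both digits of `u` zero), the sum vanishes. -/
theorem conjugatePair_digit_sum_zero (a u : TwoPlaceVal) (hu : u.vP = 0 ∧ u.vPbar = 0) :
    a.digit + (mul u a.conj).digit = 0 := by
  unfold digit mul conj; simp; omega

/-- ρ3 as posed (`v_𝔓(ab) - v_𝔓(H(a,b)) = 0` with `b = u·conj a`, `H(a,b) = a·conj b`):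
the digit equals `-(a.digit)`; it vanishes iff `a` is balanced, and is ANTI-symmetric under
`a ↦ conj a`, which is what the pair symmetrisation uses. -/
theorem rho3_digit_formula (a u : TwoPlaceVal) (hu : u.vP = 0 ∧ u.vPbar = 0) :
    let b := mul u a.conj
    (mul a b).vP - (mul a b.conj).vP = a.digit := by
  simp [mul, conj, digit]; omega

end TwoPlaceVal

/-! ## §D  PLAN 3 — (a-norm): admissible renormalisations act by units or cancel -/

/-- Doubled valuation of the Tamagawa-free quotient `Q = val·Ω·ĥ(P)/(L′·log_ω(P)²)`
as a function of the doubled valuations of its four 2-adically meaningful factors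
(`Ω/L′·ĥ` enters through one rational number `ρ`). -/
def wQ (wval wρ wlog : ℤ) : ℤ := wval + wρ - 2 * wlog

/-- The renormalisation table (LZZ Remark 1.7 + de Shalit II.4.13 (35)/(p. 70)):
Petersson rescaling by `c` hits `val` by `-wc` and each `log_ω`-normalised vector so that
`log²` moves by `-wc` in total (same pairing on both sides of Thm 1.8); abstract-conjugation
change `[t]`, `ψ ↦ ψ_a` (`a ∈ O_𝔭^×`) and the `(ζ_n)`-choice (`Nγ⁻¹`, `χ(γ)⁻¹`) act by
UNITS at a weight-0 point.  Net effect on `wQ`: zero. -/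
theorem wQ_invariant (wval wρ wlog wc wt wa wγ : ℤ)
    (ht : wt = 0) (ha : wa = 0) (hγ : wγ = 0) :
    wQ (wval - wc + wt + wa + wγ) wρ (wlog - wc) = wQ wval wρ wlog + wc := by
  unfold wQ; omega

/-- Consequently a renormalisation is INVISIBLE in `wQ` exactly when the Petersson scalar
cancels (`wc` enters `val` and `log²` with the same total weight); the residual `+ wc` above
is the ONE clause the LEAD's (a-norm) must pin: `val` and `log_ω` are read against the SAME
p-adic Petersson product.  Typed as the vanishing of that residual: -/
theorem aNorm_clause (wval wρ wlog wc : ℤ)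
    (same_pairing : wQ (wval - wc) wρ (wlog - wc) + wc = wQ (wval - 2 * wc) wρ (wlog - wc)) :
    wc = 0 := by
  unfold wQ at same_pairing; omega

end Summit.BirchSwinnertonDyer.BirchSwinnertonDyer.Cruxes.SplitBadTwoLowerHalfOfFacts.HeegnerIndexTwo.K2G15
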